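import Summits.BirchSwinnertonDyer.BirchSwinnertonDyer.Theorems.ResidualThetaTransportAtTwoSignedMuSeedAtTwoPlusEvenSymplecticFreeParity
import HarnessLib

/-!
# Seed crux `SignedMuSeedAtTwoPlus` (stmt-BirchSwinnertonDyer-21438), line `ct-involution-parity`:
# calibration of the free multiplicity III — homogeneous modules of exponent `2^k` (e.g. free `(ℤ/2^k)[G]`-modules)

Cell `bsd-wall`, width seat `bsd-wall-rtt-p4-w2` g9 (fifth file on the line's pure algebra; parents p651662 = stub S1,
p652274 = grades `k ≥ 2`, `…FreeMultSmallRank` = calibration I, `…FreeMultCalibration` = calibration II).  HONEST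
FRAMING: THEOREMS ONLY — no definition, no named fact, no instance, no `sorry`; pure algebra; closes no item; BSD is
NOT proved by any of this.

## What is proved (`m_{j+1}(A, g) = log₂ #(N(U) + U') − log₂ #U'`, `U = 2^j A ∩ A[2]`, `U' = 2^(j+1) A ∩ A[2]`,
## `N = ∑_{i<2^n} gⁱ` — the stub's `freeMult A (normElt g n) (j+1)` unfolded)

For a finite abelian group `A` which is HOMOGENEOUS OF EXPONENT `2^k` (`2^k A = 0` and `A[2] ≤ 2^(k-1) A`; e.g. any
free `ℤ/2^k`-module, in particular the free summand `(ℤ/2^k)[G_n] = (Λ/2^k)/ω_n` of stub S3) and any `g ∈ End A`: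
* `log_card_sub_log_card_of_homogeneous_eq` — in grade `k`: `m_k = log₂ #N(A[2])` (`U_k = A[2]`, `U_{k+1} = 0`);
* `log_card_sub_log_card_of_homogeneous_lt` — in grades `j+1 < k`: `m_{j+1} = 0` (`U = U' = A[2] ⊇ N(U)`);
* `log_card_sub_log_card_of_homogeneous_gt` — in grades `j+1 > k`: `m_{j+1} = 0` (`U = U' = 0`);
* `log_card_sub_log_card_of_homogeneous_of_card_eq_two` — if moreover `#N(A[2]) = 2` (one free `𝔽₂[G]`-summand in
  `A[2]`, as for `A = (ℤ/2^k)[G]`: `N(𝔽₂[G]) = 𝔽₂ · ∑_g g`), then `m_k = 1`.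
With calibration I–II: `m_{j+1}((ℤ/2^k)[G_n] ⊕ C) = [j+1 = k] + m_{j+1}(C)`. [folklore]
-/

noncomputable section

set_option autoImplicit false
set_option linter.dupNamespace false

open Finset
open Literature.GroupTheory.FiniteAbelian

namespace Summit.BirchSwinnertonDyer.BirchSwinnertonDyer.Theorems.SignedMuAtTwo.EvenSymplecticFreeParity

variable {A : Type*} [AddCommGroup A]

section Homogeneous

variable (g : AddMonoid.End A) (n : ℕ) {k : ℕ} (hexp : ∀ x : A, 2 ^ k • x = 0)
  (hhom : ∀ x : A, (2 : ℕ) • x = 0 → ∃ y : A, 2 ^ (k - 1) • y = x)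

/-- Membership in `2^c A ∩ A[2]`. [folklore] -/
theorem mem_range_nsmul_inf_torsionBy_iff (c : ℕ) (x : A) :
    x ∈ (c • AddMonoidHom.id A).range ⊓ AddSubgroup.torsionBy A 2 ↔ (∃ a : A, c • a = x) ∧ (2 : ℕ) • x = 0 := by
  rw [AddSubgroup.mem_inf, show (2 : ℤ) = ((2 : ℕ) : ℤ) from rfl, AddSubgroup.torsionBy.nsmul_iff]
  simp only [AddMonoidHom.mem_range, AddMonoidHom.nsmul_apply, AddMonoidHom.id_apply]

include hexp in
/-- In a group of exponent `2^k`, `2^c A ∩ A[2] = 0` for `c ≥ k`. [folklore] -/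
theorem range_nsmul_inf_torsionBy_eq_bot_of_le {c : ℕ} (hc : k ≤ c) :
    (2 ^ c • AddMonoidHom.id A).range ⊓ AddSubgroup.torsionBy A 2 = ⊥ := by
  rw [eq_bot_iff]
  intro x hx
  obtain ⟨⟨a, rfl⟩, -⟩ := (mem_range_nsmul_inf_torsionBy_iff _ x).mp hx
  rw [AddSubgroup.mem_bot]
  obtain ⟨d, rfl⟩ := Nat.exists_eq_add_of_le hc
  rw [pow_add, mul_nsmul, hexp, smul_zero]

include hhom in
/-- In a homogeneous group of exponent `2^k`, `2^c A ∩ A[2] = A[2]` for `c ≤ k - 1`. [folklore] -/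
theorem range_nsmul_inf_torsionBy_eq_of_le {c : ℕ} (hc : c ≤ k - 1) :
    (2 ^ c • AddMonoidHom.id A).range ⊓ AddSubgroup.torsionBy A 2 = AddSubgroup.torsionBy A 2 := by
  refine le_antisymm inf_le_right fun x hx ↦ ?_
  have h2 : (2 : ℕ) • x = 0 := by
    rw [show (2 : ℤ) = ((2 : ℕ) : ℤ) from rfl] at hx
    exact AddSubgroup.torsionBy.nsmul_iff.mp hx
  refine (mem_range_nsmul_inf_torsionBy_iff _ x).mpr ⟨?_, h2⟩
  obtain ⟨y, rfl⟩ := hhom x h2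
  obtain ⟨d, hd⟩ := Nat.exists_eq_add_of_le hc
  exact ⟨2 ^ d • y, by rw [← mul_nsmul, ← pow_add, add_comm, ← hd]⟩

include hexp hhom in
/-- **Calibration III (grade `k`).** For `A` homogeneous of exponent `2^k` (`k ≥ 1`):
`m_k(A, g) = log₂ #N(A[2])`. [folklore] -/
theorem log_card_sub_log_card_of_homogeneous_eq [Finite A] (hk : 1 ≤ k) :
    Nat.log 2 (Nat.card ↥((((2 ^ (k - 1)) • AddMonoidHom.id A).range ⊓ AddSubgroup.torsionBy A 2).map
        (∑ i ∈ Finset.range (2 ^ n), (g ^ i : AddMonoid.End A)) ⊔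
        (((2 ^ (k - 1 + 1)) • AddMonoidHom.id A).range ⊓ AddSubgroup.torsionBy A 2))) -
      Nat.log 2 (Nat.card ↥(((2 ^ (k - 1 + 1)) • AddMonoidHom.id A).range ⊓ AddSubgroup.torsionBy A 2)) =
    Nat.log 2 (Nat.card ↥((AddSubgroup.torsionBy A 2).map
        (∑ i ∈ Finset.range (2 ^ n), (g ^ i : AddMonoid.End A)))) := by
  rw [Nat.sub_add_cancel hk, range_nsmul_inf_torsionBy_eq_of_le hhom le_rfl,
    range_nsmul_inf_torsionBy_eq_bot_of_le hexp le_rfl, sup_bot_eq, AddSubgroup.card_bot,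
    Nat.log_one_right, Nat.sub_zero]

include hhom in
/-- **Calibration III (grades below `k`).** For `A` homogeneous of exponent `2^k`: `m_{j+1}(A, g) = 0` whenever
`j + 1 < k`. [folklore] -/
theorem log_card_sub_log_card_of_homogeneous_lt [Finite A] {j : ℕ} (hj : j + 1 < k) :
    Nat.log 2 (Nat.card ↥((((2 ^ j) • AddMonoidHom.id A).range ⊓ AddSubgroup.torsionBy A 2).map
        (∑ i ∈ Finset.range (2 ^ n), (g ^ i : AddMonoid.End A)) ⊔
        (((2 ^ (j + 1)) • AddMonoidHom.id A).range ⊓ AddSubgroup.torsionBy A 2))) -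
      Nat.log 2 (Nat.card ↥(((2 ^ (j + 1)) • AddMonoidHom.id A).range ⊓ AddSubgroup.torsionBy A 2)) = 0 := by
  rw [range_nsmul_inf_torsionBy_eq_of_le hhom (by omega : j ≤ k - 1),
    range_nsmul_inf_torsionBy_eq_of_le hhom (by omega : j + 1 ≤ k - 1), sup_eq_right.mpr, Nat.sub_self]
  refine AddSubgroup.map_le_iff_le_comap.mpr fun x hx ↦ ?_
  have h2 : (2 : ℤ) • x = 0 := (Submodule.mem_torsionBy_iff _ _).mp hx
  change _ ∈ AddSubgroup.torsionBy A 2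
  rw [AddSubgroup.torsionBy, Submodule.mem_toAddSubgroup, Submodule.mem_torsionBy_iff, ← map_zsmul, h2, map_zero]

include hexp in
/-- **Calibration III (grades above `k`).** For `A` of exponent `2^k`: `m_{j+1}(A, g) = 0` whenever `j + 1 > k`.
[folklore] -/
theorem log_card_sub_log_card_of_homogeneous_gt [Finite A] {j : ℕ} (hj : k < j + 1) :
    Nat.log 2 (Nat.card ↥((((2 ^ j) • AddMonoidHom.id A).range ⊓ AddSubgroup.torsionBy A 2).map
        (∑ i ∈ Finset.range (2 ^ n), (g ^ i : AddMonoid.End A)) ⊔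
        (((2 ^ (j + 1)) • AddMonoidHom.id A).range ⊓ AddSubgroup.torsionBy A 2))) -
      Nat.log 2 (Nat.card ↥(((2 ^ (j + 1)) • AddMonoidHom.id A).range ⊓ AddSubgroup.torsionBy A 2)) = 0 := by
  have hU : ((2 ^ j) • AddMonoidHom.id A).range ⊓ AddSubgroup.torsionBy A 2 = ⊥ :=
    range_nsmul_inf_torsionBy_eq_bot_of_le hexp (Nat.lt_succ_iff.mp hj)
  have hU' : ((2 ^ (j + 1)) • AddMonoidHom.id A).range ⊓ AddSubgroup.torsionBy A 2 = ⊥ :=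
    range_nsmul_inf_torsionBy_eq_bot_of_le hexp hj.le
  rw [hU, hU', AddSubgroup.map_bot, bot_sup_eq, Nat.sub_self]

include hexp hhom in
/-- **Calibration III (the unit).** For `A` homogeneous of exponent `2^k` (`k ≥ 1`) with `#N(A[2]) = 2` — e.g. the
free module `(ℤ/2^k)[G_n]` with `g` = translation by a generator, where `A[2] = 𝔽₂[G_n]` and `N(𝔽₂[G_n]) = 𝔽₂·∑g`
— the grade-`k` free multiplicity is `m_k(A, g) = 1`. [folklore] -/
theorem log_card_sub_log_card_of_homogeneous_of_card_eq_two [Finite A] (hk : 1 ≤ k)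
    (hN : Nat.card ↥((AddSubgroup.torsionBy A 2).map (∑ i ∈ Finset.range (2 ^ n), (g ^ i : AddMonoid.End A))) = 2) :
    Nat.log 2 (Nat.card ↥((((2 ^ (k - 1)) • AddMonoidHom.id A).range ⊓ AddSubgroup.torsionBy A 2).map
        (∑ i ∈ Finset.range (2 ^ n), (g ^ i : AddMonoid.End A)) ⊔
        (((2 ^ (k - 1 + 1)) • AddMonoidHom.id A).range ⊓ AddSubgroup.torsionBy A 2))) -
      Nat.log 2 (Nat.card ↥(((2 ^ (k - 1 + 1)) • AddMonoidHom.id A).range ⊓ AddSubgroup.torsionBy A 2)) = 1 := by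
  rw [log_card_sub_log_card_of_homogeneous_eq g n hexp hhom hk, hN]
  decide
end Homogeneous

end Summit.BirchSwinnertonDyer.BirchSwinnertonDyer.Theorems.SignedMuAtTwo.EvenSymplecticFreeParity

end
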